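import Literature.AlgebraicGeometry.Frobenioids.BaseIdentityPreStepsSlim
import Literature.AlgebraicGeometry.Frobenioids.EquivalenceUnitsDivSlim
import HarnessLib

/-!
# Frobenioids I, Theorem 3.4 (v), first sentence: over SLIM bases an equivalence of Frobenioids
# preserves base-identity ENDOMORPHISMS (all Frobenius degrees)

Mochizuki, *The geometry of Frobenioids I: the general theory*, Kyushu J. Math. **62** (2008)
293–400, Thm. 3.4 (v), kurims text p. 63 ll. 22–25: "(c) `D₁`, `D₂` are slim. Then `Ψ` preserves the
base-identity endomorphisms …" (proof pp. 67–69 via the categories `P_i := C_i^pl-bk` and the equivalences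
`(P_i)_A ⥲ (D_i)_{A_D}` of Def. 1.3 (i)(c)) [cite: MochizukiFrdI2008, Thm. 3.4 (v) p.63].

PROOF-ONLY file (seat abc-iut-w4-d109; sub-node `FrdI:Thm3.4(v)/L12a BaseIdentityEndosPreserved` of the L1
SUBDAG for [FrdI] Thm. 3.4, the general endomorphism case — the automorphism case `O^×(−)` is abc-iut-L1-d4's
`EquivalenceUnitsSlim.lean`). The argument, over found's Def. 1.1–1.3 files and the interface
`PreFrobenioidData.EndPlbkBsIso` (seat abc-iut-L1-t3):

* `PreFrobenioidData.exists_endPlbkBsIso_of_isBaseIdentity` — a base-identity endomorphism `δ` of `A` (of any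
  Frobenius degree) extends, by the unique lifting along pull-back morphisms (Def. 1.2 (ii)), to a compatible
  family `δ_{(B, φ)}` of BASE-IDENTITY endomorphisms indexed by the pull-back morphisms `φ : B → A`, i.e. to an
  element of `End((P)_A → C)^bs-iso` with component `δ` at `id_A` (the endomorphism analogue of the `φ_f` of
  the proof of Cor. 4.11 (i), p. 92);
* `PreFrobenioid.isBaseIdentity_app_of_isSlim` — over a SLIM base every element of `End((P)_A → C)^bs-iso` has
  base-identity components: its shadow on `D_{A_D} → D` through the equivalence of Def. 1.3 (i)(c) is an
  automorphism of that functor, trivial by slimness (the `P_i`-argument of p. 67);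
* `PreFrobenioidData.exists_transport_endPlbkBsIso_hom` — transport of `End((P₁)_{Ψ⁻¹B} → C₁)^bs-iso` along an
  equivalence `Ψ` whose quasi-inverse preserves pull-back morphisms and which preserves base-isomorphisms
  (Thm. 3.4 (iii));
* `PreFrobenioid.isBaseIdentity_map_of_isSlim` — hence such a `Ψ` carries base-identity endomorphisms of `C₁`
  to base-identity endomorphisms of `C₂` whenever `D₂` is slim: NO hypothesis on `C₁` beyond the pre-Frobenioid
  structure, and on `C₂` only Def. 1.3 (i)(c).

No statement of the paper is restated or strengthened; no new definitions; nothing here is specific to the abc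
programme.
-/

namespace Literature.AlgebraicGeometry.Frobenioids

open CategoryTheory Opposite

universe w₁ w₂ v₁ v₁' v₂ v₂' u₁ u₁' u₂ u₂'

namespace PreFrobenioidData

section Transport

variable {C₁ : Type u₁} [Category.{v₁} C₁] {D₁ : Type u₁'} [Category.{v₁'} D₁]
variable {C₂ : Type u₂} [Category.{v₂} C₂] {D₂ : Type u₂'} [Category.{v₂'} D₂]
variable (S₁ : PreFrobenioidData.{w₁} C₁ D₁) (S₂ : PreFrobenioidData.{w₂} C₂ D₂)

/-- The components of an element of `End(C^pl-bk_A → C)^bs-iso` do not depend on how the indexing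
pull-back morphism is written. [cite: MochizukiFrdI2008, Prop. 3.3 (i) p.59] -/
theorem EndPlbkBsIso.app_congr_of_eq {A : C₁} (N : S₁.EndPlbkBsIso A) {B : C₁} {φ φ' : B ⟶ A} (e : φ = φ')
    (h : S₁.IsPullbackMorphism φ) (h' : S₁.IsPullbackMorphism φ') : N.app φ h = N.app φ' h' := by
  subst e
  rfl

/-- **Transport of `End((P₁)_{Ψ⁻¹ B} → C₁)^bs-iso` to `End((P₂)_B → C₂)^bs-iso` along an equivalence**
(FrdI proof of Thm. 3.4 (iv), p. 66: "`Ψ` preserves pre-steps, base-isomorphisms, and pull-back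
morphisms, hence … preserves endomorphisms satisfying the above condition"): for `Ψ : C₁ ⥲ C₂` whose
quasi-inverse carries pull-back morphisms to pull-back morphisms and which carries base-isomorphisms to
base-isomorphisms, a compatible family `N` of base-isomorphic endomorphisms indexed by the pull-back
morphisms into `Ψ⁻¹ B` yields the family `χ ↦ ε_Y⁻¹ ∘ Ψ(N_{Ψ⁻¹ χ}) ∘ ε_Y` (`ε` the counit) indexed by the
pull-back morphisms `χ : Y → B`; this is a homomorphism of monoids.
[cite: MochizukiFrdI2008, Thm. 3.4 (iv) p.66] -/
theorem exists_transport_endPlbkBsIso_hom (Ψ : C₁ ≌ C₂)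
    (hpb' : ∀ ⦃Y Z : C₂⦄ (δ : Y ⟶ Z), S₂.IsPullbackMorphism δ → S₁.IsPullbackMorphism (Ψ.inverse.map δ))
    (hbi : ∀ ⦃X Y : C₁⦄ (f : X ⟶ Y), S₁.IsBaseIso f → S₂.IsBaseIso (Ψ.functor.map f)) (B : C₂) :
    ∃ T : S₁.EndPlbkBsIso (Ψ.inverse.obj B) →* S₂.EndPlbkBsIso B,
      ∀ (N : S₁.EndPlbkBsIso (Ψ.inverse.obj B)) ⦃Y : C₂⦄ (χ : Y ⟶ B) (hχ : S₂.IsPullbackMorphism χ),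
        ∃ e : Ψ.functor.obj (Ψ.inverse.obj Y) ≅ Y, e = Ψ.counitIso.app Y ∧
          (T N).app χ hχ = e.inv ≫ Ψ.functor.map (N.app (Ψ.inverse.map χ) (hpb' χ hχ)) ≫ e.hom := by
  -- the counit, with its two naturality squares
  have hεty : ∀ Y : C₂, ∃ e : Ψ.functor.obj (Ψ.inverse.obj Y) ≅ Y, e = Ψ.counitIso.app Y :=
    fun Y => ⟨_, rfl⟩
  choose ε hε₀ using hεty
  have hε : ∀ {Y Y' : C₂} (g : Y ⟶ Y'), g ≫ (ε Y').inv = (ε Y).inv ≫ Ψ.functor.map (Ψ.inverse.map g) := by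
    intro Y Y' g
    rw [hε₀ Y, hε₀ Y']
    have := Ψ.counitIso.inv.naturality g
    dsimp at this
    exact this
  have hε' : ∀ {Y Y' : C₂} (g : Y ⟶ Y'),
      Ψ.functor.map (Ψ.inverse.map g) ≫ (ε Y').hom = (ε Y).hom ≫ g := by
    intro Y Y' g
    rw [hε₀ Y, hε₀ Y']
    have := Ψ.counitIso.hom.naturality g
    dsimp at this
    exact this
  -- the transported family
  let a : S₁.EndPlbkBsIso (Ψ.inverse.obj B) → ∀ ⦃Y : C₂⦄ (χ : Y ⟶ B), S₂.IsPullbackMorphism χ → End Y :=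
    fun N Y χ hχ => (ε Y).inv ≫ Ψ.functor.map (N.app (Ψ.inverse.map χ) (hpb' χ hχ)) ≫ (ε Y).hom
  have ha : ∀ (N : S₁.EndPlbkBsIso (Ψ.inverse.obj B)) ⦃Y : C₂⦄ (χ : Y ⟶ B)
      (hχ : S₂.IsPullbackMorphism χ),
      a N χ hχ = (ε Y).inv ≫ Ψ.functor.map (N.app (Ψ.inverse.map χ) (hpb' χ hχ)) ≫ (ε Y).hom :=
    fun _ _ _ _ => rfl
  let t : S₁.EndPlbkBsIso (Ψ.inverse.obj B) → S₂.EndPlbkBsIso B := fun N =>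
    { app := a N
      naturality := by
        intro Y Y' χ hχ χ' hχ' g hg
        have hg' : Ψ.inverse.map g ≫ Ψ.inverse.map χ = Ψ.inverse.map χ' := by
          rw [← Ψ.inverse.map_comp, hg]
        have hnat := N.naturality (Ψ.inverse.map χ) (hpb' χ hχ) (Ψ.inverse.map χ') (hpb' χ' hχ')
          (Ψ.inverse.map g) hg'
        have hnat' : Ψ.functor.map (Ψ.inverse.map g) ≫
            Ψ.functor.map (N.app (Ψ.inverse.map χ) (hpb' χ hχ)) =
              Ψ.functor.map (N.app (Ψ.inverse.map χ') (hpb' χ' hχ')) ≫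
                Ψ.functor.map (Ψ.inverse.map g) := by
          rw [← Ψ.functor.map_comp, hnat, Ψ.functor.map_comp]
        change g ≫ ((ε Y).inv ≫ Ψ.functor.map (N.app (Ψ.inverse.map χ) (hpb' χ hχ)) ≫ (ε Y).hom) =
          ((ε Y').inv ≫ Ψ.functor.map (N.app (Ψ.inverse.map χ') (hpb' χ' hχ')) ≫ (ε Y').hom) ≫ g
        rw [← Category.assoc g, hε g, Category.assoc, ← Category.assoc (Ψ.functor.map _),
          hnat', Category.assoc, hε' g]
        simp only [Category.assoc]
      isBaseIso := by
        intro Y χ hχ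
        change IsIso (S₂.base.map ((ε Y).inv ≫
          Ψ.functor.map (N.app (Ψ.inverse.map χ) (hpb' χ hχ)) ≫ (ε Y).hom))
        rw [S₂.base.map_comp, S₂.base.map_comp]
        haveI : IsIso (S₂.base.map (Ψ.functor.map (N.app (Ψ.inverse.map χ) (hpb' χ hχ)))) :=
          hbi _ (N.isBaseIso (Ψ.inverse.map χ) (hpb' χ hχ))
        infer_instance }
  have ht : ∀ (N : S₁.EndPlbkBsIso (Ψ.inverse.obj B)) ⦃Y : C₂⦄ (χ : Y ⟶ B)
      (hχ : S₂.IsPullbackMorphism χ), (t N).app χ hχ = a N χ hχ := fun _ _ _ _ => rfl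
  refine ⟨{ toFun := t, map_one' := ?_, map_mul' := ?_ }, fun N Y χ hχ => ?_⟩
  · refine EndPlbkBsIso.ext' fun Y χ hχ => ?_
    rw [ht, EndPlbkBsIso.one_app, ha 1 χ hχ, EndPlbkBsIso.one_app]
    change (ε Y).inv ≫ Ψ.functor.map (𝟙 _) ≫ (ε Y).hom = 𝟙 Y
    rw [Ψ.functor.map_id, Category.id_comp, Iso.inv_hom_id]
  · intro N M
    refine EndPlbkBsIso.ext' fun Y χ hχ => ?_
    rw [EndPlbkBsIso.mul_app, ht, ht, ht, ha (N * M) χ hχ, ha N χ hχ, ha M χ hχ, EndPlbkBsIso.mul_app,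
      End.mul_def, End.mul_def, Ψ.functor.map_comp]
    simp only [Category.assoc, Iso.hom_inv_id_assoc]
  · exact ⟨ε Y, hε₀ Y, rfl⟩

end Transport

end PreFrobenioidData

/-! ### Extending a base-identity endomorphism over the pull-back morphisms -/

namespace PreFrobenioidData

section Extend

variable {C : Type u₁} [Category.{v₁} C] {D : Type u₁'} [Category.{v₁'} D] (S : PreFrobenioidData.{w₁} C D)

/-- **A base-identity endomorphism extends to `End((P)_A → C)^bs-iso`** (FrdI Def. 1.2 (ii), the unique
lifting along a pull-back morphism `φ : B → A` of the pair `(φ ∘ δ… = δ ∘ φ, id_{B_D})`; cf. the `φ_f` of the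
proof of Cor. 4.11 (i), p. 92): for `δ ∈ End(A)` with `Base(δ) = id` there is a compatible family of
base-identity endomorphisms `δ_φ ∈ End(B)`, `φ : B → A` a pull-back morphism, with `δ_φ ≫ φ = φ ≫ δ` and
`δ_{id_A} = δ`. [cite: MochizukiFrdI2008, Thm. 3.4 (v) p.67] -/
theorem exists_endPlbkBsIso_of_isBaseIdentity {A : C} (δ : A ⟶ A) (hδ : S.IsBaseIdentity δ) :
    ∃ N : S.EndPlbkBsIso A,
      (∀ ⦃B : C⦄ (φ : B ⟶ A) (hφ : S.IsPullbackMorphism φ),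
          (N.app φ hφ : B ⟶ B) ≫ φ = φ ≫ δ ∧ S.IsBaseIdentity (N.app φ hφ)) ∧
        ∀ h : S.IsPullbackMorphism (𝟙 A), N.app (𝟙 A) h = δ := by
  have hb : ∀ ⦃B : C⦄ (φ : B ⟶ A), 𝟙 _ ≫ S.base.map φ = S.base.map (φ ≫ δ) := by
    intro B φ
    rw [Functor.map_comp, show S.base.map δ = 𝟙 _ from hδ, Category.id_comp, Category.comp_id]
  have hex : ∀ ⦃B : C⦄ (φ : B ⟶ A) (hφ : S.IsPullbackMorphism φ),
      ∃! ψ : B ⟶ B, ψ ≫ φ = φ ≫ δ ∧ S.base.map ψ = 𝟙 _ := fun B φ hφ => hφ (φ ≫ δ) (𝟙 _) (hb φ)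
  refine ⟨{ app := fun B φ hφ => (hex φ hφ).exists.choose
            naturality := ?_
            isBaseIso := ?_ }, fun B φ hφ => ?_, fun h => ?_⟩
  · intro B B' φ hφ φ' hφ' g hg
    have h1 := (hex φ hφ).exists.choose_spec
    have h2 := (hex φ' hφ').exists.choose_spec
    -- both `g ≫ δ_φ` and `δ_φ' ≫ g` lift `(φ' ≫ δ, Base g)` along the pull-back morphism `φ`
    have hβ : S.base.map g ≫ S.base.map φ = S.base.map (φ' ≫ δ) := by
      rw [← Functor.map_comp, hg, Functor.map_comp, show S.base.map δ = 𝟙 _ from hδ, Category.comp_id]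
    obtain ⟨ψ, -, huniq⟩ := hφ (φ' ≫ δ) (S.base.map g) hβ
    have e1 : g ≫ (hex φ hφ).exists.choose = ψ := huniq _ ⟨by rw [Category.assoc, h1.1, ← Category.assoc, hg],
      by rw [Functor.map_comp, h1.2, Category.comp_id]⟩
    have e2 : (hex φ' hφ').exists.choose ≫ g = ψ := huniq _ ⟨by rw [Category.assoc, hg, h2.1],
      by rw [Functor.map_comp, h2.2, Category.id_comp]⟩
    change g ≫ (hex φ hφ).exists.choose = (hex φ' hφ').exists.choose ≫ g
    rw [e1, e2]
  · intro B φ hφ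
    change IsIso (S.base.map (hex φ hφ).exists.choose)
    rw [(hex φ hφ).exists.choose_spec.2]
    infer_instance
  · exact ⟨(hex φ hφ).exists.choose_spec.1, (hex φ hφ).exists.choose_spec.2⟩
  · have h1 := (hex (𝟙 A) h).exists.choose_spec
    exact (hex (𝟙 A) h).unique ⟨h1.1, h1.2⟩ ⟨by rw [Category.id_comp, Category.comp_id], hδ⟩

end Extend

end PreFrobenioidData

/-! ### Over a slim base the components of `End((P)_A → C)^bs-iso` are base-identity endomorphisms -/

namespace PreFrobenioid

section Slim

variable {D : Type u₁'} [Category.{v₁'} D] {Φ : Dᵒᵖ ⥤ CommMonCat.{w₁}} {C : Type u₁} [Category.{v₁} C]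
  {F : C ⥤ ElemFrobenioid Φ}

open PreFrobenioidData (ofFunctor)

/-- **Slimness kills the base of every compatible family** (the `P_i`-argument of the proof of Thm. 3.4 (v),
p. 67: "since the category `D_i`, hence also the categories `(D_i)_{A_D}`, `(P_i)_A`, are slim …"): for a
Frobenioid `F : C → F_Φ` over a slim `D`, every element `N` of `End(C^pl-bk_A → C)^bs-iso` has base-identity
components — its shadow on `D_{A_D} → D` (through the equivalence `C^pl-bk_A ⥲ D_{A_D}` of Def. 1.3 (i)(c))
is an automorphism of that functor, hence trivial. [cite: MochizukiFrdI2008, Thm. 3.4 (v) p.67] -/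
theorem isBaseIdentity_app_of_isSlim (hF : IsFrobenioid F) (hD : IsSlim D) (A : C)
    (N : (ofFunctor Φ F).EndPlbkBsIso A) ⦃B : C⦄ (φ : B ⟶ A) (hφ : (ofFunctor Φ F).IsPullbackMorphism φ) :
    IsBaseIdentity F (N.app φ hφ) := by
  classical
  -- Def. 1.3 (i)(c): the equivalence `E : C^pl-bk_A ⥲ D_{A_D}` and the forgetful `U : D_{A_D} → D`
  let A' : PullbackCat F := ⟨A⟩
  let E := pullbackSliceToBase F A
  haveI : E.IsEquivalence := hF.i_c A
  let X₀ : D := (wideSubcategoryInclusion (pullbackMorphisms F) ⋙ baseFunctor F).obj A'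
  let U : Over X₀ ⥤ D := Over.forget X₀
  have hpb : ∀ p : Over A', (ofFunctor Φ F).IsPullbackMorphism p.hom.hom := fun p =>
    (PreFrobenioidData.ofFunctor_isPullbackMorphism F _).mpr p.hom.property
  -- the shadow of `N` on `E ⋙ U`
  let θ : End (E ⋙ U) :=
    { app := fun p => Base F (N.app p.hom.hom (hpb p))
      naturality := by
        intro p p' f
        have hg : f.left.hom ≫ p'.hom.hom = p.hom.hom := congrArg (fun k => k.hom) (Over.w f)
        have := N.naturality p'.hom.hom (hpb p') p.hom.hom (hpb p) f.left.hom hg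
        change Base F f.left.hom ≫ Base F (N.app p'.hom.hom (hpb p')) =
          Base F (N.app p.hom.hom (hpb p)) ≫ Base F f.left.hom
        rw [← base_comp, ← base_comp, this] }
  have hunit : IsUnit θ := by
    rw [isUnit_iff_isIso]
    haveI : ∀ p : Over A', IsIso (θ.app p) := fun p => N.isBaseIso p.hom.hom (hpb p)
    exact NatIso.isIso_of_isIso_app _
  -- transport to `Aut(D_{A_D} → D)` along `(End _)ˣ ≃ Aut (E ⋙ U) ≃ Aut U` (whiskering by `E`), trivial by slimness
  have hW : ((Functor.whiskeringLeft (Over A') (Over X₀) D).obj E).FullyFaithful :=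
    Functor.FullyFaithful.ofFullyFaithful _
  let e₁ : (End (E ⋙ U))ˣ ≃* Aut (E ⋙ U) := Aut.unitsEndEquivAut (E ⋙ U)
  let e₂ : Aut U ≃* Aut (E ⋙ U) := hW.autMulEquivOfFullyFaithful U
  let ι : (End (E ⋙ U))ˣ →* Aut U := e₂.symm.toMonoidHom.comp e₁.toMonoidHom
  have hone : ι hunit.unit = 1 := by
    have := hD.isRigid_forget X₀ (ι hunit.unit)
    rw [this]
    rfl
  have hθ : θ = 1 := by
    have h1 : hunit.unit = 1 := by
      have hinj : Function.Injective ι := e₂.symm.injective.comp e₁.injective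
      exact hinj (by rw [hone, map_one])
    have := congrArg Units.val h1
    rwa [IsUnit.unit_spec, Units.val_one] at this
  -- read off the component at `(B, φ)`
  have hφ' : pullbackMorphisms F φ := (PreFrobenioidData.ofFunctor_isPullbackMorphism F φ).mp hφ
  let p₀ : Over A' := Over.mk (⟨φ, hφ'⟩ : (⟨B⟩ : PullbackCat F) ⟶ A')
  have key := congrArg (fun t : End (E ⋙ U) => t.app p₀) hθ
  exact key

end Slim

/-! ### `Ψ` preserves base-identity endomorphisms over a slim `D₂` -/

section Two

variable {D₁ : Type u₁'} [Category.{v₁'} D₁] {Φ₁ : D₁ᵒᵖ ⥤ CommMonCat.{w₁}} {C₁ : Type u₁}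
  [Category.{v₁} C₁] {D₂ : Type u₁'} [Category.{v₁'} D₂] {Φ₂ : D₂ᵒᵖ ⥤ CommMonCat.{w₁}} {C₂ : Type u₁}
  [Category.{v₁} C₂] {F₁ : C₁ ⥤ ElemFrobenioid Φ₁} {F₂ : C₂ ⥤ ElemFrobenioid Φ₂}

open PreFrobenioidData (ofFunctor)

/-- **[FrdI] Thm. 3.4 (v), first sentence, base-identity endomorphisms** (p. 63 ll. 22–25): let `C₂` be a
Frobenioid over a SLIM `D₂` and `Ψ : C₁ ⥲ C₂` an equivalence carrying base-isomorphisms to base-isomorphisms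
whose quasi-inverse carries pull-back morphisms to pull-back morphisms (Thm. 3.4 (iii)). Then `Ψ` carries every
base-identity endomorphism `δ` of `C₁` (of any Frobenius degree) to a base-identity endomorphism of `C₂`:
extend `δ` (conjugated to `Ψ⁻¹Ψ A`) to `End((P₁)_{Ψ⁻¹Ψ A} → C₁)^bs-iso`, transport along `Ψ`, and read off the
component at `id_{Ψ A}`, whose base is trivial by slimness of `D₂`. [cite: MochizukiFrdI2008, Thm. 3.4 (v) p.63] -/
theorem isBaseIdentity_map_of_isSlim (hF₂ : IsFrobenioid F₂) (hslim₂ : IsSlim D₂) (Ψ : C₁ ≌ C₂)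
    (hbi : ∀ ⦃X Y : C₁⦄ (f : X ⟶ Y), IsBaseIso F₁ f → IsBaseIso F₂ (Ψ.functor.map f))
    (hpb' : ∀ ⦃Y Z : C₂⦄ (δ : Y ⟶ Z), IsPullbackMorphism F₂ δ → IsPullbackMorphism F₁ (Ψ.inverse.map δ))
    {A : C₁} {δ : A ⟶ A} (hδ : IsBaseIdentity F₁ δ) : IsBaseIdentity F₂ (Ψ.functor.map δ) := by
  have hpbS : ∀ ⦃Y Z : C₂⦄ (χ : Y ⟶ Z), (ofFunctor Φ₂ F₂).IsPullbackMorphism χ →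
      (ofFunctor Φ₁ F₁).IsPullbackMorphism (Ψ.inverse.map χ) := fun Y Z χ hχ =>
    (PreFrobenioidData.ofFunctor_isPullbackMorphism F₁ _).mpr
      (hpb' χ ((PreFrobenioidData.ofFunctor_isPullbackMorphism F₂ χ).mp hχ))
  have hbiS : ∀ ⦃X Y : C₁⦄ (f : X ⟶ Y), (ofFunctor Φ₁ F₁).IsBaseIso f →
      (ofFunctor Φ₂ F₂).IsBaseIso (Ψ.functor.map f) := hbi
  -- conjugate `δ` to `Ψ⁻¹Ψ A` and extend it over the pull-back morphisms
  let u : A ≅ Ψ.inverse.obj (Ψ.functor.obj A) := Ψ.unitIso.app A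
  have hδ' : IsBaseIdentity F₁ (u.inv ≫ δ ≫ u.hom) := hδ.conj_iso u
  obtain ⟨N, -, hN⟩ := (ofFunctor Φ₁ F₁).exists_endPlbkBsIso_of_isBaseIdentity (u.inv ≫ δ ≫ u.hom) hδ'
  -- transport along `Ψ`; slimness of `D₂` at the component `id_{Ψ A}`
  obtain ⟨T, hT⟩ := PreFrobenioidData.exists_transport_endPlbkBsIso_hom (ofFunctor Φ₁ F₁)
    (ofFunctor Φ₂ F₂) Ψ hpbS hbiS (Ψ.functor.obj A)
  obtain ⟨e, -, he⟩ := hT N (𝟙 _) ((ofFunctor Φ₂ F₂).isPullbackMorphism_id _)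
  have h1 : IsBaseIdentity F₂ ((T N).app (𝟙 _) ((ofFunctor Φ₂ F₂).isPullbackMorphism_id _)) :=
    isBaseIdentity_app_of_isSlim hF₂ hslim₂ _ (T N) (𝟙 _) _
  rw [he, PreFrobenioidData.EndPlbkBsIso.app_congr_of_eq (ofFunctor Φ₁ F₁) N (Ψ.inverse.map_id _)
    (hpbS _ ((ofFunctor Φ₂ F₂).isPullbackMorphism_id _)) ((ofFunctor Φ₁ F₁).isPullbackMorphism_id _),
    hN] at h1
  -- `h1 : Base(e⁻¹ ≫ Ψ(u⁻¹ ≫ δ ≫ u) ≫ e) = id`; conjugate back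
  have h2 := h1.conj_iso (e.symm ≪≫ (Ψ.functor.mapIso u).symm)
  have h3 : (e.symm ≪≫ (Ψ.functor.mapIso u).symm).inv ≫
      (e.inv ≫ Ψ.functor.map (u.inv ≫ δ ≫ u.hom) ≫ e.hom) ≫ (e.symm ≪≫ (Ψ.functor.mapIso u).symm).hom =
        Ψ.functor.map δ := by
    simp
  rw [h3] at h2
  exact h2

end Two

end PreFrobenioid

end Literature.AlgebraicGeometry.Frobenioids
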